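import Summits.BirchSwinnertonDyer.BirchSwinnertonDyer.Theorems.EisensteinPrimesBSDpOnCellCTelescopeCarrierSplit
import Summits.BirchSwinnertonDyer.BirchSwinnertonDyer.Theorems.SignedBaseChangeAnticyclotomicEisensteinDivisibilitySpecializationHerbrand
import Summits.BirchSwinnertonDyer.BirchSwinnertonDyer.Theorems.EisensteinPrimesBSDpOnCellCTelescopeCarrierAlgOfWitness
import HarnessLib

/-!
# [telescope v16 — successor LEAD cruxlead-19034 g4, 2026-08-30] PREFIX⁺ RE-PORT: the road-prefix package of the leaves gains two trailing conjuncts,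
# (wt) `∃ M, ∀ k, (p : ℤ_[p])^M * x k = ((D k).k − 2 : ℤ)` (the chart variable IS the rescaled weight — `IsPNewBranchAnalyticChart` clause (wt)) and
# (rat) `∀ k, Function.Surjective (algebraMap ℤ_[p] (padicCoeffIntegers (D k).ι))` (the members on the étale branch through the RATIONAL newform f_E are
# ℚ_p-rational — print: Hida 1986 Cor. 1.4, Greenberg–Stevens 1993 §2, Venerucci 2016 §2.4; typer flag T1-R0), so that the construction leaf N1 no longer
# CLAIMS (rat_k) about its input (width x2-p2 g23 `N1-TYPING-x2p2g23.md`, ideator g40 `N1-PRICING.md` §0; LEAD ruling STATUS 08:45:48Z). Statement = the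
# F-form original with the two conjuncts appended at EVERY occurrence of the package; proof token-identical.
# THIS FILE = `TelescopeCarrierAlgOfWitnessF` (member clauses in F-form) on prefix⁺, hypothesis and conclusion. (`--supports`, helper; closes nothing; THEOREMS ONLY; BSD proved for no curve.)
-/

set_option autoImplicit false
set_option linter.dupNamespace false

noncomputable section

open scoped Classical MatrixGroups ModularForm

open CongruenceSubgroup WeierstrassCurve NumberField IsDedekindDomain Field PowerSeries
  Literature.NumberTheory.EllipticCurves Literature.NumberTheory.EllipticCurves.GreenbergSelmer
  Literature.NumberTheory.EllipticCurves.ModularForms Literature.NumberTheory.QuadraticFields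
  Literature.NumberTheory.EllipticCurves.Rank1Residual
  Literature.NumberTheory.EllipticCurves.Rank1Residual.Typed
  Literature.NumberTheory.GaloisRepresentations Literature.NumberTheory.GaloisCohomology
  Summit.BirchSwinnertonDyer.Rank1Residual.X11b.AcSelmer
  Summit.BirchSwinnertonDyer.Rank1Residual.X11b.Halves
  Summit.BirchSwinnertonDyer.Rank1Residual.X11b
  Summit.BirchSwinnertonDyer.Rank1Residual Summit.BirchSwinnertonDyer.Rank1Residual.X1
  Summit.BirchSwinnertonDyer.Rank1Residual.X2
open Literature.NumberTheory.EllipticCurves.BigGaloisRep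
open Literature.NumberTheory.EllipticCurves.Castella2018

namespace Summit.BirchSwinnertonDyer.BirchSwinnertonDyer.Theorems.TelescopeCarrierAlgOfWitnessFP

open Summit.BirchSwinnertonDyer.BirchSwinnertonDyer.Theorems

set_option maxHeartbeats 1600000 in
/-- **KERNEL K2 (rebased on v3; statements inlined).** v3's `stub_carrierAlg` from the module-level witness (K2-W) and the Herbrand brick (K2-H): per member `k`,
apply K2-H to the evaluation retraction `φ_k = map (evAt x_k) : R₀⟦X⟧⟦T⟧ → R₀⟦T⟧` (kernel `(X − x_k)`), `π = X − x_k`, `N = 𝒩`; with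
`char 𝒩 = (F)` this is `char(𝒩/(X − x_k)𝒩) ≤ (F(x_k, T))`; push along `unrToCpInt` and chain under (ctrl_k): that is (alg_k) with
`Φ_k := F(x_k, T)`, `G_k := 1`, the remainder clause being the kernel property. Sorry-free. -/
theorem carrierAlg_of_witness
    (hW : ∀ (W : WeierstrassCurve ℚ) [W.IsElliptic] [W.IsGloballyMinimal] (p : ℕ) [Fact p.Prime],
    ∀ (N : ℕ) [NeZero N] (K : Type) [Field K] [NumberField K] (Dt : ModularParametrizationData W N)
      (H : HeegnerDatum N (NumberField.discr K)) (ιK : K →+* ℂ) (P : (W.baseChange K).toAffine.Point),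
      CellC W p → W.conductorNorm ℤ = N →
      IsImaginaryQuadratic K → NumberField.discr K < -4 → SatisfiesHeegnerHypothesis N K →
      (W.quadraticTwist (NumberField.discr K : ℚ)).entireLFunction 1 ≠ 0 →
      WeierstrassCurve.Affine.Point.map ιK.toRatAlgHom P = heegnerPointComplex Dt H →
      ¬ (p : ℤ) ∣ Dt.c → ¬ IsOfFinAddOrder P →
      Odd (NumberField.discr K) →
      ∀ (κ : ZpExtension K p), κ.IsAnticyclotomic →
        ∀ (γ : Field.absoluteGaloisGroup K) [Fact (κ.IsTopGenerator γ)]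
          (𝔭 : HeightOneSpectrum (𝓞 K)), ((p : ℕ) : 𝓞 K) ∈ 𝔭.asIdeal →
          𝔭.asIdeal.ramificationIdx (𝓞 ℚ) = 1 → 𝔭.asIdeal.inertiaDeg (𝓞 ℚ) = 1 →
          ∀ (𝔭bar : HeightOneSpectrum (𝓞 K)), ((p : ℕ) : 𝓞 K) ∈ 𝔭bar.asIdeal → 𝔭bar ≠ 𝔭 →
            ((Ideal.span {(p : ℤ)}).primesOver (𝓞 K)).ncard = 2 →
          ∀ (f : CuspForm (CongruenceSubgroup.Gamma0 N) 2), IsNewformOf W f →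
            ∀ (ι' : PadicAlgCl p ≃+* ℂ),
              (∀ (w : InfinitePlace K) (k : 𝓞 K),
                k ∈ 𝔭.asIdeal ↔ ‖ι'.symm (w.embedding (k : K))‖ < 1) →
              ∀ (ΩK : ℂ) (Ωp : ℂ_[p]) (Q : PowerSeries 𝓞_ℂ_[p]), ΩK ≠ 0 → ‖Ωp‖ = 1 →
                R1.IsBDPLFunctionInt p ι' 𝔭 κ γ f ΩK Ωp Q →
      ∀ (L : PowerSeries (PowerSeries (unrIntegers p))) (x : ℕ → ℤ_[p]) (D : ℕ → Skinner2016.HidaCongruentForm W p 1),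
        (∀ k, ‖x k‖ < 1) ∧ Filter.Tendsto x Filter.atTop (nhds 0) ∧
        (∃ e : ℕ, PowerSeries.C ((p : 𝓞_ℂ_[p]) ^ e) * Q ∈
          Ideal.span {PowerSeries.map (R1.unrToCpInt p) (PowerSeries.map (PowerSeries.constantCoeff (R := unrIntegers p)) L)}) ∧
        (∀ k : ℕ, (∀ y : coeffField (D k).g, ι' ((D k).ι y) = (y : ℂ)) ∧ 2 * ((p : ℤ) - 1) ∣ (D k).k - 2 ∧
          ∃ (ΩKg : ℂ) (Ωpg : ℂ_[p]) (Lg : UnrSeries p), ΩKg ≠ 0 ∧ ‖Ωpg‖ = 1 ∧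
            IsBDPLFunctionWt ι' 𝔭 κ γ (D k).g ΩKg Ωpg Lg ∧
          ∃ Ψ : UnrSeries p,
            (∃ U : PowerSeries (PowerSeries (unrIntegers p)),
              PowerSeries.map (PowerSeries.C (R := unrIntegers p)) Ψ =
                L + PowerSeries.C (PowerSeries.X - PowerSeries.C (toUnr p (x k))) * U) ∧
            (∃ e : ℕ, PowerSeries.C ((p : 𝓞_ℂ_[p]) ^ e) * PowerSeries.map (R1.unrToCpInt p) Ψ ∈
              Ideal.span {PowerSeries.map (R1.unrToCpInt p) Lg})) ∧
        (∃ A : ℕ → UnrSeries p, ∀ ℓ : ℕ, ℓ.Prime → ¬ ℓ ∣ N →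
          (∃ U : UnrSeries p, A ℓ = PowerSeries.C (toUnr p ((W.frobeniusTrace ℓ : ℤ) : ℤ_[p])) + PowerSeries.X * U) ∧
          ∀ k : ℕ, ∃ (c : unrIntegers p) (U : UnrSeries p),
            A ℓ = PowerSeries.C c + (PowerSeries.X - PowerSeries.C (toUnr p (x k))) * U ∧
            ((c : ℂ_[p]) = algebraMap (PadicAlgCl p) ℂ_[p]
              ((D k).ι ⟨(UpperHalfPlane.qExpansion 1 ⇑(D k).g).coeff ℓ, coeff_mem_coeffField (D k).g ℓ⟩))) ∧
        (∃ M : ℕ, ∀ k : ℕ, ((p : ℤ_[p]) ^ M) * x k = (((D k).k - 2 : ℤ) : ℤ_[p])) ∧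
        (∀ k : ℕ, Function.Surjective (algebraMap ℤ_[p] (padicCoeffIntegers (D k).ι))) →
      ∃ (F : PowerSeries (PowerSeries (unrIntegers p)))
        (𝒩 : Type) (_ : AddCommGroup 𝒩) (_ : Module (PowerSeries (PowerSeries (unrIntegers p))) 𝒩)
        (_ : Module (PowerSeries (unrIntegers p)) 𝒩)
        (_ : IsScalarTower (PowerSeries (unrIntegers p)) (PowerSeries (PowerSeries (unrIntegers p))) 𝒩)
        (_ : Module.Finite (PowerSeries (PowerSeries (unrIntegers p))) 𝒩),
        Literature.NumberTheory.EllipticCurves.Module.charIdeal (PowerSeries (PowerSeries (unrIntegers p))) 𝒩 =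
          Ideal.span {F} ∧
        ¬ (PowerSeries.C (PowerSeries.X : PowerSeries (unrIntegers p)) ∣ F) ∧
        (∃ j : ℕ, PowerSeries.C ((p : 𝓞_ℂ_[p]) ^ j) *
            PowerSeries.map (R1.unrToCpInt p) (PowerSeries.map (PowerSeries.constantCoeff (R := unrIntegers p)) F) ∈
          (XAc.charIdeal (W.baseChange K) p κ 𝔭bar ∅ γ).map (PowerSeries.map (R1.toCpInt p))) ∧
        ∃ bad : Set ℤ_[p], bad.Finite ∧ ∀ k : ℕ, x k ∉ bad →
          (∃ s : PowerSeries (PowerSeries (unrIntegers p)),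
            ¬ (PowerSeries.C (PowerSeries.X - PowerSeries.C (toUnr p (x k))) ∣ s) ∧ ∀ m : 𝒩, s • m = 0) ∧
          ∀ (b : padicCoeffIntegers (D k).ι →+* 𝓞_ℂ_[p]),
            (∀ y, ((b y : 𝓞_ℂ_[p]) : ℂ_[p]) =
              algebraMap (PadicAlgCl p) ℂ_[p] (padicCoeffIntegers.toPadicAlgCl (D k).ι y)) →
          ∀ [TopologicalSpace (PowerSeries (padicCoeffIntegers (D k).ι))]
            [ContinuousSMul (PowerSeries (padicCoeffIntegers (D k).ι))
              (BigRepModule (padicCoeffIntegers (D k).ι) p (Cofree (D k).Δ.selfDualRep (padicCoeffField (D k).ι)))],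
            ∃ j : ℕ, Ideal.span {PowerSeries.C ((p : 𝓞_ℂ_[p]) ^ j)} *
                (XBig.charIdeal κ ((D k).Δ.selfDualCofreeRepOver K) 𝔭bar
                  (∅ : Set (HeightOneSpectrum (𝓞 K)))).map (PowerSeries.map b) ≤
              (Literature.NumberTheory.EllipticCurves.Module.charIdeal (PowerSeries (unrIntegers p))
                  (QuotSMulTop (PowerSeries.C (PowerSeries.X - PowerSeries.C (toUnr p (x k)))) 𝒩)).map
                (PowerSeries.map (R1.unrToCpInt p)))
    (hHer : ∀ (A B : Type) [CommRing A] [CommRing B] [IsDomain A] [IsDomain B] [IsNoetherianRing A] [IsNoetherianRing B]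
      [Algebra A B], UniqueFactorizationMonoid A → UniqueFactorizationMonoid B →
    ∀ (π : B) (φ : B →+* A),
      (∀ a : A, φ (algebraMap A B a) = a) → φ π = 0 → (∀ b : B, φ b = 0 → π ∣ b) →
    ∀ (N : Type) [AddCommGroup N] [Module B N] [Module A N] [IsScalarTower A B N] [Module.Finite B N],
      (∃ s : B, ¬ π ∣ s ∧ ∀ m : N, s • m = 0) →
      Literature.NumberTheory.EllipticCurves.Module.charIdeal A (QuotSMulTop π N) ≤
        (Literature.NumberTheory.EllipticCurves.Module.charIdeal B N).map φ) :
    ∀ (W : WeierstrassCurve ℚ) [W.IsElliptic] [W.IsGloballyMinimal] (p : ℕ) [Fact p.Prime],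
    ∀ (N : ℕ) [NeZero N] (K : Type) [Field K] [NumberField K] (Dt : ModularParametrizationData W N)
      (H : HeegnerDatum N (NumberField.discr K)) (ιK : K →+* ℂ) (P : (W.baseChange K).toAffine.Point),
      CellC W p → W.conductorNorm ℤ = N →
      IsImaginaryQuadratic K → NumberField.discr K < -4 → SatisfiesHeegnerHypothesis N K →
      (W.quadraticTwist (NumberField.discr K : ℚ)).entireLFunction 1 ≠ 0 →
      WeierstrassCurve.Affine.Point.map ιK.toRatAlgHom P = heegnerPointComplex Dt H →
      ¬ (p : ℤ) ∣ Dt.c → ¬ IsOfFinAddOrder P →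
      Odd (NumberField.discr K) →
      ∀ (κ : ZpExtension K p), κ.IsAnticyclotomic →
        ∀ (γ : Field.absoluteGaloisGroup K) [Fact (κ.IsTopGenerator γ)]
          (𝔭 : HeightOneSpectrum (𝓞 K)), ((p : ℕ) : 𝓞 K) ∈ 𝔭.asIdeal →
          𝔭.asIdeal.ramificationIdx (𝓞 ℚ) = 1 → 𝔭.asIdeal.inertiaDeg (𝓞 ℚ) = 1 →
          ∀ (𝔭bar : HeightOneSpectrum (𝓞 K)), ((p : ℕ) : 𝓞 K) ∈ 𝔭bar.asIdeal → 𝔭bar ≠ 𝔭 →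
            ((Ideal.span {(p : ℤ)}).primesOver (𝓞 K)).ncard = 2 →
          ∀ (f : CuspForm (CongruenceSubgroup.Gamma0 N) 2), IsNewformOf W f →
            ∀ (ι' : PadicAlgCl p ≃+* ℂ),
              (∀ (w : InfinitePlace K) (k : 𝓞 K),
                k ∈ 𝔭.asIdeal ↔ ‖ι'.symm (w.embedding (k : K))‖ < 1) →
              ∀ (ΩK : ℂ) (Ωp : ℂ_[p]) (Q : PowerSeries 𝓞_ℂ_[p]), ΩK ≠ 0 → ‖Ωp‖ = 1 →
                R1.IsBDPLFunctionInt p ι' 𝔭 κ γ f ΩK Ωp Q →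
      ∀ (L : PowerSeries (PowerSeries (unrIntegers p))) (x : ℕ → ℤ_[p]) (D : ℕ → Skinner2016.HidaCongruentForm W p 1),
        (∀ k, ‖x k‖ < 1) ∧ Filter.Tendsto x Filter.atTop (nhds 0) ∧
        (∃ e : ℕ, PowerSeries.C ((p : 𝓞_ℂ_[p]) ^ e) * Q ∈
          Ideal.span {PowerSeries.map (R1.unrToCpInt p) (PowerSeries.map (PowerSeries.constantCoeff (R := unrIntegers p)) L)}) ∧
        (∀ k : ℕ, (∀ y : coeffField (D k).g, ι' ((D k).ι y) = (y : ℂ)) ∧ 2 * ((p : ℤ) - 1) ∣ (D k).k - 2 ∧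
          ∃ (ΩKg : ℂ) (Ωpg : ℂ_[p]) (Lg : UnrSeries p), ΩKg ≠ 0 ∧ ‖Ωpg‖ = 1 ∧
            IsBDPLFunctionWt ι' 𝔭 κ γ (D k).g ΩKg Ωpg Lg ∧
          ∃ Ψ : UnrSeries p,
            (∃ U : PowerSeries (PowerSeries (unrIntegers p)),
              PowerSeries.map (PowerSeries.C (R := unrIntegers p)) Ψ =
                L + PowerSeries.C (PowerSeries.X - PowerSeries.C (toUnr p (x k))) * U) ∧
            (∃ e : ℕ, PowerSeries.C ((p : 𝓞_ℂ_[p]) ^ e) * PowerSeries.map (R1.unrToCpInt p) Ψ ∈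
              Ideal.span {PowerSeries.map (R1.unrToCpInt p) Lg})) ∧
        (∃ A : ℕ → UnrSeries p, ∀ ℓ : ℕ, ℓ.Prime → ¬ ℓ ∣ N →
          (∃ U : UnrSeries p, A ℓ = PowerSeries.C (toUnr p ((W.frobeniusTrace ℓ : ℤ) : ℤ_[p])) + PowerSeries.X * U) ∧
          ∀ k : ℕ, ∃ (c : unrIntegers p) (U : UnrSeries p),
            A ℓ = PowerSeries.C c + (PowerSeries.X - PowerSeries.C (toUnr p (x k))) * U ∧
            ((c : ℂ_[p]) = algebraMap (PadicAlgCl p) ℂ_[p]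
              ((D k).ι ⟨(UpperHalfPlane.qExpansion 1 ⇑(D k).g).coeff ℓ, coeff_mem_coeffField (D k).g ℓ⟩))) ∧
        (∃ M : ℕ, ∀ k : ℕ, ((p : ℤ_[p]) ^ M) * x k = (((D k).k - 2 : ℤ) : ℤ_[p])) ∧
        (∀ k : ℕ, Function.Surjective (algebraMap ℤ_[p] (padicCoeffIntegers (D k).ι))) →
      ∃ F : PowerSeries (PowerSeries (unrIntegers p)),
        ¬ (PowerSeries.C (PowerSeries.X : PowerSeries (unrIntegers p)) ∣ F) ∧
        (∃ j : ℕ, PowerSeries.C ((p : 𝓞_ℂ_[p]) ^ j) *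
            PowerSeries.map (R1.unrToCpInt p) (PowerSeries.map (PowerSeries.constantCoeff (R := unrIntegers p)) F) ∈
          (XAc.charIdeal (W.baseChange K) p κ 𝔭bar ∅ γ).map (PowerSeries.map (R1.toCpInt p))) ∧
        ∃ bad : Set ℤ_[p], bad.Finite ∧ ∀ k : ℕ, x k ∉ bad → ∃ Φ : UnrSeries p,
          (∃ G U : PowerSeries (PowerSeries (unrIntegers p)),
            PowerSeries.map (PowerSeries.C (R := unrIntegers p)) Φ =
              F * G + PowerSeries.C (PowerSeries.X - PowerSeries.C (toUnr p (x k))) * U) ∧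
          ∀ (b : padicCoeffIntegers (D k).ι →+* 𝓞_ℂ_[p]),
            (∀ y, ((b y : 𝓞_ℂ_[p]) : ℂ_[p]) =
              algebraMap (PadicAlgCl p) ℂ_[p] (padicCoeffIntegers.toPadicAlgCl (D k).ι y)) →
          ∀ [TopologicalSpace (PowerSeries (padicCoeffIntegers (D k).ι))]
            [ContinuousSMul (PowerSeries (padicCoeffIntegers (D k).ι))
              (BigRepModule (padicCoeffIntegers (D k).ι) p (Cofree (D k).Δ.selfDualRep (padicCoeffField (D k).ι)))],
            ∃ j : ℕ, Ideal.span {PowerSeries.C ((p : 𝓞_ℂ_[p]) ^ j)} *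
                (XBig.charIdeal κ ((D k).Δ.selfDualCofreeRepOver K) 𝔭bar
                  (∅ : Set (HeightOneSpectrum (𝓞 K)))).map (PowerSeries.map b) ≤
              Ideal.span {PowerSeries.map (R1.unrToCpInt p) Φ} := by
  intro W _ _ p _ N _ K _ _ Dt H ιK P hC hN hK hdisc hHeeg hL1 hP hc hfin hodd κ hκ γ _ 𝔭 h𝔭 hram hdeg 𝔭bar
    h𝔭bar hne hsp f hf ι' hι' ΩK Ωp Q hΩK hΩp hQ L x D hpkg
  obtain ⟨F, 𝒩, _i1, _i2, _i3, _i4, _i5, hchar, hF, halg, Fx, hFx, hmem⟩ :=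
    hW W p N K Dt H ιK P hC hN hK hdisc hHeeg hL1 hP hc hfin hodd κ hκ γ 𝔭 h𝔭 hram hdeg 𝔭bar h𝔭bar hne
      hsp f hf ι' hι' ΩK Ωp Q hΩK hΩp hQ L x D hpkg
  have hxk : ∀ k, ‖x k‖ < 1 := hpkg.1
  -- the receptacle `R₀ = unrIntegers p`: a complete DVR with uniformiser `p`; `R₀⟦T⟧`, `R₀⟦X⟧⟦T⟧` factorial
  haveI := HidaLimitAlgebra.isDiscreteValuationRing_unrIntegers (p := p)
  haveI : IsAdicComplete (IsLocalRing.maximalIdeal (unrIntegers p)) (unrIntegers p) :=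
    CongruentShaFreeCutUnrSeriesWeierstrass.isAdicComplete_maximalIdeal
  haveI : UniqueFactorizationMonoid (PowerSeries (PowerSeries (unrIntegers p))) :=
    Literature.NumberTheory.IwasawaTheory.uniqueFactorizationMonoid_powerSeries_powerSeries (unrIntegers p)
  haveI : UniqueFactorizationMonoid (PowerSeries (unrIntegers p)) := TelescopeCarrierAlgOfWitness.uniqueFactorizationMonoid_unrSeries p
  have hirr : Irreducible ((p : ℕ) : unrIntegers p) := HidaLimitAlgebra.irreducible_natCast_p
  have hpmem : ((p : ℕ) : unrIntegers p) ∈ IsLocalRing.maximalIdeal (unrIntegers p) :=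
    (IsLocalRing.mem_maximalIdeal _).mpr hirr.not_isUnit
  have hpt : ∀ z : ℤ_[p], ‖z‖ < 1 → toUnr p z ∈ IsLocalRing.maximalIdeal (unrIntegers p) := by
    intro z hz
    obtain ⟨y, hy⟩ := (PadicInt.norm_lt_one_iff_dvd z).mp hz
    rw [hy, map_mul, map_natCast]
    exact Ideal.mul_mem_right _ _ hpmem
  refine ⟨F, hF, halg, Fx, hFx, fun k hk => ?_⟩
  obtain ⟨⟨s, hsπ, hs⟩, hctrl⟩ := hmem k hk
  have ha : toUnr p (x k) ∈ IsLocalRing.maximalIdeal (unrIntegers p) := hpt _ (hxk k)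
  -- the evaluation retraction `φ_k : R₀⟦X⟧⟦T⟧ → R₀⟦T⟧`, `X ↦ x_k` (inner variable), kernel `(X - x_k)`
  let φ : PowerSeries (PowerSeries (unrIntegers p)) →+* PowerSeries (unrIntegers p) :=
    PowerSeries.map (AccumHelpers.evAt (toUnr p (x k)) ha).toRingHom
  have hφC : ∀ g : PowerSeries (unrIntegers p),
      φ (algebraMap (PowerSeries (unrIntegers p)) (PowerSeries (PowerSeries (unrIntegers p))) g) = g :=
    fun g => TelescopeCarrierAlgOfWitness.evAtMap_map_C _ ha g
  have hφπ : φ (PowerSeries.C (PowerSeries.X - PowerSeries.C (toUnr p (x k)))) = 0 := TelescopeCarrierAlgOfWitness.evAtMap_pi _ ha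
  have hφker : ∀ b : PowerSeries (PowerSeries (unrIntegers p)), φ b = 0 →
      PowerSeries.C (PowerSeries.X - PowerSeries.C (toUnr p (x k))) ∣ b :=
    fun b hb => TelescopeCarrierAlgOfWitness.C_dvd_of_evAtMap_eq_zero _ ha b hb
  -- ONE-SIDED HERBRAND at the member fibre: `char_{R₀⟦T⟧}(𝒩 / (X - x_k)𝒩) ⊆ (F(x_k, T))`
  have hle := hHer (PowerSeries (unrIntegers p)) (PowerSeries (PowerSeries (unrIntegers p)))
    inferInstance inferInstance
    (PowerSeries.C (PowerSeries.X - PowerSeries.C (toUnr p (x k)))) φ hφC hφπ hφker 𝒩 ⟨s, hsπ, hs⟩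
  rw [hchar, Ideal.map_span, Set.image_singleton] at hle
  refine ⟨φ F, ?_, ?_⟩
  · -- the fibre `Φ_k := F(x_k, T)` as a remainder: `Φ_k ≡ F (mod X - x_k)`
    obtain ⟨U, hU⟩ := hφker (PowerSeries.map (PowerSeries.C (R := unrIntegers p)) (φ F) - F) (by
      rw [map_sub, sub_eq_zero]
      exact hφC (φ F))
    exact ⟨1, U, by rw [mul_one, ← hU]; ring⟩
  · intro b hb _ _
    obtain ⟨j, hj⟩ := hctrl b hb
    refine ⟨j, hj.trans ?_⟩
    have hle' := Ideal.map_mono (f := PowerSeries.map (R1.unrToCpInt p)) hle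
    rwa [Ideal.map_span, Set.image_singleton] at hle'

end Summit.BirchSwinnertonDyer.BirchSwinnertonDyer.Theorems.TelescopeCarrierAlgOfWitnessFP

end
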